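import Mathlib
import Literature.Analysis.Calculus.SmoothCutoff
import Summits.SmoothPoincare4.SmoothPoincare4.Theorems.EntropyRungSubcylindricalExistenceCapProfileOpening

/-!
# Cap profile, step 2: the slope defect `P(t)`
(aux `helper_capProfile_slope` for stub `helper_capProfile` of line
`fat-conical-core-avr-logsobolev`, crux `EntropyRung.SubcylindricalExistence`, item
stmt-SmoothPoincare4-10871)

In log-radius `t = ½ log s` the log-slope `Q = 2 s prof'/prof` of the cap profile is `Q = P - 2`
with the "slope defect" `P ≥ 0`; the scalar-curvature condition `2 prof' + s prof'' ≤ 0` reads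
`P' ≤ P (2 - P)`. Here we build `P` itself: smooth, equal to the round defect
`2a²/(a² + e^{2t})` for `t ≤ t_B`, equal to the cone defect `1 - c` for `t ≥ t_c`
(`e^{2 t_c} ≤ smax`), with `P' ≤ P(2 - P)`, `0 ≤ P ≤ 1 - c + κ₁` and `|P(t₁) - P(t₂)| ≤ κ₁` on
windows of length `ℓ` beyond `t_B - ℓ`.

Construction: `P(t) = (1 - ST(t - t_B - 1)) · ρ(t - t_a) + G(t - t_B)` with the round defect
`ρ(u) = 2/(1 + e^{2u})` (`ρ' = -ρ(2 - ρ)`), `a = e^{t_a}`, the smooth step `ST`, and the opening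
function `G` of step 1 (`helper_capProfile_opening`); the junction `t_B - t_a` is placed far out on
the round profile and everything is translated so that `t_c = ½ log smax`.
-/

noncomputable section

set_option linter.dupNamespace false

open scoped ContDiff Topology
open Set Filter Literature.Analysis.Calculus

namespace Summit.SmoothPoincare4.SmoothPoincare4.Theorems

namespace CapProfileSlope

/-- The round defect `ρ(u) = 2/(1 + e^{2u})` has `ρ' = -ρ(2 - ρ)`. -/
theorem hasDerivAt_rho (u : ℝ) :
    HasDerivAt (fun u : ℝ => 2 / (1 + Real.exp (2 * u)))
      (-(2 / (1 + Real.exp (2 * u)) * (2 - 2 / (1 + Real.exp (2 * u))))) u := by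
  have hE : HasDerivAt (fun u : ℝ => Real.exp (2 * u)) (Real.exp (2 * u) * 2) u := by
    simpa using ((hasDerivAt_id u).const_mul (2 : ℝ)).exp
  have hpos : 0 < 1 + Real.exp (2 * u) := by positivity
  refine ((hasDerivAt_const u (2 : ℝ)).fun_div (hE.const_add 1) hpos.ne').congr_deriv ?_
  field_simp
  ring

/-- `0 < ρ`. -/
theorem rho_pos (u : ℝ) : 0 < 2 / (1 + Real.exp (2 * u)) := by positivity

/-- `ρ < 2`. -/
theorem rho_lt_two (u : ℝ) : 2 / (1 + Real.exp (2 * u)) < 2 :=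
  div_lt_self two_pos (by linarith [Real.exp_pos (2 * u)])

/-- `ρ(u) ≤ 2 e^{-2u}`. -/
theorem rho_le_exp (u : ℝ) : 2 / (1 + Real.exp (2 * u)) ≤ 2 * Real.exp (-2 * u) := by
  rw [show -2 * u = -(2 * u) by ring, Real.exp_neg, ← div_eq_mul_inv]
  exact div_le_div_of_nonneg_left zero_le_two (Real.exp_pos _) (by linarith)

/-- `ρ` is antitone. -/
theorem rho_antitone : Antitone (fun u : ℝ => 2 / (1 + Real.exp (2 * u))) := by
  refine antitone_of_deriv_nonpos (fun u => (hasDerivAt_rho u).differentiableAt) fun u => ?_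
  rw [(hasDerivAt_rho u).deriv, neg_nonpos]
  exact mul_nonneg (rho_pos u).le (by linarith [rho_lt_two u])

/-- The round defect in the `a`-form: `2/(1 + e^{2(t - t_a)}) = 2a²/(a² + e^{2t})`, `a = e^{t_a}`. -/
theorem rho_eq_round (ta t : ℝ) :
    2 / (1 + Real.exp (2 * (t - ta))) =
      2 * Real.exp ta ^ 2 / (Real.exp ta ^ 2 + Real.exp (2 * t)) := by
  have h1 : Real.exp (2 * (t - ta)) = Real.exp (2 * t) / Real.exp ta ^ 2 := by
    rw [show 2 * (t - ta) = 2 * t - 2 * ta by ring, Real.exp_sub]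
    congr 1
    simpa using Real.exp_nat_mul ta 2
  have h2 : 0 < Real.exp ta ^ 2 := by positivity
  rw [h1]
  field_simp

end CapProfileSlope

open CapProfileSlope CapProfileOpening in
/-- **The slope defect.** For `0 < c ≤ 1`, `κ₁ > 0`, `ℓ ≥ 1`, `smax > 0` there are a smooth
`P : ℝ → ℝ` and reals `a > 0`, `t_B < t_c` with `e^{2t_c} ≤ smax` such that
`P(t) = 2a²/(a² + e^{2t})` for `t ≤ t_B`, `P(t) = 1 - c` for `t ≥ t_c`, `P' ≤ P(2 - P)`
everywhere, `|P(t₁) - P(t₂)| ≤ κ₁` for `t_B - ℓ ≤ t₁ ≤ t₂ ≤ t₁ + ℓ`, and `0 ≤ P ≤ 1 - c + κ₁` on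
`[t_B - ℓ, ∞)`. -/
theorem helper_capProfile_slope :
    ∀ c : ℝ, 0 < c → c ≤ 1 → ∀ κ₁ : ℝ, 0 < κ₁ → ∀ ℓ : ℝ, 1 ≤ ℓ → ∀ smax : ℝ, 0 < smax →
      ∃ P : ℝ → ℝ, ∃ a tB tc : ℝ, ContDiff ℝ ∞ P ∧ 0 < a ∧ tB < tc ∧ Real.exp (2 * tc) ≤ smax ∧
        (∀ t, t ≤ tB → P t = 2 * a ^ 2 / (a ^ 2 + Real.exp (2 * t))) ∧
        (∀ t, tc ≤ t → P t = 1 - c) ∧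
        (∀ t, deriv P t ≤ P t * (2 - P t)) ∧
        (∀ t₁ t₂, tB - ℓ ≤ t₁ → t₁ ≤ t₂ → t₂ ≤ t₁ + ℓ → |P t₁ - P t₂| ≤ κ₁) ∧
        (∀ t, tB - ℓ ≤ t → 0 ≤ P t ∧ P t ≤ 1 - c + κ₁) := by
  intro c hc hc1 κ₁ hκ₁ ℓ hℓ smax hsmax
  -- the shrunken tolerance `k` and the junction offset `d`
  set k : ℝ := min κ₁ c with hk
  have hk0 : 0 < k := lt_min hκ₁ hc
  have hkκ : k ≤ κ₁ := min_le_left _ _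
  have hkc : k ≤ c := min_le_right _ _
  set ρ : ℝ → ℝ := fun u => 2 / (1 + Real.exp (2 * u)) with hρ
  set d : ℝ := ℓ + Real.log (4 / k) / 2 with hd
  have hρd : ρ (d - ℓ) ≤ k / 2 := by
    refine (rho_le_exp (d - ℓ)).trans (le_of_eq ?_)
    rw [show -2 * (d - ℓ) = -Real.log (4 / k) by rw [hd]; ring, Real.exp_neg,
      Real.exp_log (by positivity)]
    field_simp
    norm_num
  -- the opening function with rate `k/(8ℓ)` and start-up bound `ρ(d + 1)`
  obtain ⟨G, L, hGs, hL2, hG0, hGL, hGmem, hGd, hGd0, hGd1, hGdG⟩ :=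
    helper_capProfile_opening c hc hc1 (k / (8 * ℓ)) (by positivity) (ρ (d + 1)) (rho_pos _)
  have hGdiff : Differentiable ℝ G := hGs.differentiable (by simp)
  have hGmono : Monotone G := monotone_of_deriv_nonneg hGdiff fun u => (hGd u).1
  -- the translation
  set tc : ℝ := Real.log smax / 2 with htc
  set tB : ℝ := tc - L with htB
  set ta : ℝ := tB - d with hta
  set P : ℝ → ℝ := fun t =>
    (1 - Real.smoothTransition (t - tB - 1)) * ρ (t - ta) + G (t - tB) with hP
  -- smoothness
  have hρs : ContDiff ℝ ∞ ρ :=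
    contDiff_const.div (contDiff_const.add (contDiff_const.mul contDiff_id).exp)
      fun u => (by positivity : (0 : ℝ) < 1 + Real.exp (2 * u)).ne'
  have hPs : ContDiff ℝ ∞ P :=
    ((contDiff_const.sub (Real.smoothTransition.contDiff.comp
      ((contDiff_id.sub contDiff_const).sub contDiff_const))).mul
      (hρs.comp (contDiff_id.sub contDiff_const))).add (hGs.comp (contDiff_id.sub contDiff_const))
  -- the derivative of `P`
  have hPd : ∀ t, HasDerivAt P (-(deriv Real.smoothTransition (t - tB - 1)) * ρ (t - ta)
      - (1 - Real.smoothTransition (t - tB - 1)) * (ρ (t - ta) * (2 - ρ (t - ta)))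
      + deriv G (t - tB)) t := by
    intro t
    have h0 : HasDerivAt (fun t : ℝ => t - tB - 1) 1 t := by
      simpa using ((hasDerivAt_id' t).sub_const tB).sub_const 1
    have h0' : HasDerivAt (fun t : ℝ => t - ta) 1 t := by
      simpa using (hasDerivAt_id' t).sub_const ta
    have h0'' : HasDerivAt (fun t : ℝ => t - tB) 1 t := by
      simpa using (hasDerivAt_id' t).sub_const tB
    have h1 := (differentiable_smoothTransition (t - tB - 1)).hasDerivAt.comp t h0
    have h2 := (hasDerivAt_rho (t - ta)).comp t h0'
    have h3 := (hGdiff (t - tB)).hasDerivAt.comp t h0''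
    refine ((((hasDerivAt_const t (1 : ℝ)).fun_sub h1).fun_mul h2).fun_add h3).congr_deriv ?_
    simp only [hρ, Function.comp]
    ring
  -- values of the round defect along the construction
  have hρanti : Antitone ρ := rho_antitone
  have hρ_small : ∀ t, tB - ℓ ≤ t → ρ (t - ta) ≤ k / 2 := fun t ht =>
    (hρanti (by rw [hta]; linarith)).trans hρd
  have hP0 : ∀ t, 0 ≤ P t := fun t =>
    add_nonneg (mul_nonneg (sub_nonneg.2 (Real.smoothTransition.le_one _)) (rho_pos _).le)
      (hGmem _).1
  have hP_le : ∀ t, P t ≤ ρ (t - ta) + G (t - tB) := fun t => by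
    have : (1 - Real.smoothTransition (t - tB - 1)) * ρ (t - ta) ≤ 1 * ρ (t - ta) :=
      mul_le_mul_of_nonneg_right (by linarith [Real.smoothTransition.nonneg (t - tB - 1)])
        (rho_pos _).le
    simp only [hP]
    linarith
  refine ⟨P, Real.exp ta, tB, tc, hPs, Real.exp_pos ta, by linarith, ?_, ?_, ?_, ?_, ?_, ?_⟩
  · -- `e^{2 t_c} = smax`
    rw [htc, mul_div_cancel₀ _ (two_ne_zero' ℝ), Real.exp_log hsmax]
  · -- round for `t ≤ t_B`
    intro t ht
    have h1 : Real.smoothTransition (t - tB - 1) = 0 :=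
      Real.smoothTransition.zero_of_nonpos (by linarith)
    simp only [hP, h1, hG0 (t - tB) (by linarith), hρ]
    rw [sub_zero, one_mul, add_zero]
    exact rho_eq_round ta t
  · -- cone for `t_c ≤ t`
    intro t ht
    have h1 : Real.smoothTransition (t - tB - 1) = 1 :=
      Real.smoothTransition.one_of_one_le (by rw [htB] at *; linarith)
    simp only [hP, h1, hGL (t - tB) (by rw [htB]; linarith)]
    ring
  · -- the differential inequality `P' ≤ P (2 - P)`
    intro t
    rw [(hPd t).deriv]
    have hr0 := rho_pos (t - ta)
    have hr2 := rho_lt_two (t - ta)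
    have hS0 := Real.smoothTransition.nonneg (t - tB - 1)
    have hS1 := Real.smoothTransition.le_one (t - tB - 1)
    have hS' := Real.smoothTransition.monotone.deriv_nonneg (x := t - tB - 1)
    have hg0 := (hGmem (t - tB)).1
    rcases le_or_gt t tB with h1 | h1
    · -- before the junction: pure round profile
      have hSz : Real.smoothTransition (t - tB - 1) = 0 :=
        Real.smoothTransition.zero_of_nonpos (by linarith)
      have hGz : G (t - tB) = 0 := hG0 _ (by linarith)
      have hGdz : deriv G (t - tB) = 0 := hGd0 _ (by linarith)
      simp only [hP, hSz, hGz, hGdz, hρ] at *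
      nlinarith
    have hrs : ρ (t - ta) ≤ 1 / 2 := by
      have := hρ_small t (by linarith [(le_trans zero_le_one hℓ)])
      have hk1 : k ≤ 1 := hkc.trans hc1
      linarith
    rcases le_or_gt t (tB + 1) with h2 | h2
    · -- the start-up window `t_B ≤ t ≤ t_B + 1`
      have hSz : Real.smoothTransition (t - tB - 1) = 0 :=
        Real.smoothTransition.zero_of_nonpos (by linarith)
      have hSdz : deriv Real.smoothTransition (t - tB - 1) = 0 :=
        deriv_smoothTransition_of_nonpos (by linarith)
      have hgd : deriv G (t - tB) ≤ ρ (t - ta) :=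
        (hGd1 _ (by linarith)).trans (hρanti (by rw [hta]; linarith))
      have hg1 := (hGmem (t - tB)).2
      simp only [hP, hSz, hSdz, hρ] at *
      nlinarith
    · -- beyond the start-up: `G' ≤ G ≤ P ≤ P (2 - P)`
      have hgd : deriv G (t - tB) ≤ G (t - tB) := hGdG _ (by linarith)
      have hg1 := (hGmem (t - tB)).2
      have hPt1 : P t ≤ 1 := by
        have := hP_le t
        have := hρ_small t (by linarith)
        linarith
      have hPt0 := hP0 t
      have hPG : G (t - tB) ≤ P t := by
        simp only [hP]
        nlinarith
      calc _ ≤ deriv G (t - tB) := by nlinarith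
        _ ≤ P t := hgd.trans hPG
        _ = P t * 1 := (mul_one _).symm
        _ ≤ P t * (2 - P t) := mul_le_mul_of_nonneg_left (by linarith) hPt0
  · -- slow variation on windows of length `ℓ`
    intro t₁ t₂ h1 h12 h2
    have hr1 := hρ_small t₁ h1
    have hr2 := hρ_small t₂ (by linarith)
    have hg : G (t₂ - tB) - G (t₁ - tB) ≤ k / (8 * ℓ) * (t₂ - tB - (t₁ - tB)) :=
      image_sub_le_mul_sub_of_deriv_le hGdiff (fun u => (hGd u).2) (by linarith)
    have hg' : G (t₁ - tB) ≤ G (t₂ - tB) := hGmono (by linarith)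
    have hgk : k / (8 * ℓ) * (t₂ - tB - (t₁ - tB)) ≤ k / 8 := by
      rw [show t₂ - tB - (t₁ - tB) = t₂ - t₁ by ring]
      calc k / (8 * ℓ) * (t₂ - t₁) ≤ k / (8 * ℓ) * ℓ :=
            mul_le_mul_of_nonneg_left (by linarith) (by positivity)
        _ = k / 8 := by field_simp
    have hm1 : 0 ≤ (1 - Real.smoothTransition (t₁ - tB - 1)) * ρ (t₁ - ta) :=
      mul_nonneg (sub_nonneg.2 (Real.smoothTransition.le_one _)) (rho_pos _).le
    have hm2 : 0 ≤ (1 - Real.smoothTransition (t₂ - tB - 1)) * ρ (t₂ - ta) :=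
      mul_nonneg (sub_nonneg.2 (Real.smoothTransition.le_one _)) (rho_pos _).le
    have hM1 : (1 - Real.smoothTransition (t₁ - tB - 1)) * ρ (t₁ - ta) ≤ 1 * ρ (t₁ - ta) :=
      mul_le_mul_of_nonneg_right (by linarith [Real.smoothTransition.nonneg (t₁ - tB - 1)])
        (rho_pos _).le
    have hM2 : (1 - Real.smoothTransition (t₂ - tB - 1)) * ρ (t₂ - ta) ≤ 1 * ρ (t₂ - ta) :=
      mul_le_mul_of_nonneg_right (by linarith [Real.smoothTransition.nonneg (t₂ - tB - 1)])
        (rho_pos _).le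
    simp only [hP]
    rw [abs_le]
    constructor <;> linarith
  · -- range on `[t_B - ℓ, ∞)`
    intro t ht
    refine ⟨hP0 t, ?_⟩
    have := hP_le t
    have := hρ_small t ht
    have := (hGmem (t - tB)).2
    linarith

end Summit.SmoothPoincare4.SmoothPoincare4.Theorems

end
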